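import Summits.AtomisticToContinuum.Crystallization.Theorems.ChargedEnergyGapSeparatedCounting
import HarnessLib

/-!
# Charged energy gap — lens-3 g62, part P-T: the stacking LEDGER at the hcp cell (critic row 1155 (f) «SWITCH lemma»)

Cell `decomp-a2c`, seat lens-3, generation 62, part P-T (after P-S).  ELEMENTARY·PROVED word combinatorics in the language of P-R
(`IsBarlowWord`, `registryTerm`, `wordSurplus`).  Row 1155 (f) asked for the reference-switch / flank-borrowing rule of memo g62 §1.2 row 1
(«h-runs ≤ 1300 layers borrow from flanks; thick hcp regions switch reference; worst ratio 0.28») as a decidable lemma.  The lemma filed here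
DISSOLVES the switch: if the chart's reference CELL is the hcp cell `(a*, h*)` throughout (the competitor's stacking is carried by absorbed seams,
P-O, at no transfer cost), then the first-order loss sits on the c-TYPE layers (`cInd w L = 1`: the two neighbours of `L` carry different letters) and
every c-type layer `L` deposits the registry gain `b 2` on EACH of its two neighbours (`wordSurplusSide_ge_cInd`: the `k = 2` term of the neighbour's
surplus is `b 2 · cInd`, the `k = 3` term is `≥ 0` because `b 3 ≤ 0`, all later pairs are `≥ 0` by P-R).  Hence in EVERY window `[A, B]` of EVERY
Barlow word (`ledger_window`): `2·b₂·#{c-type layers in [A,B]} ≤ Σ_{L ∈ [A−1, B+1]} wordSurplus(L)`, and the losses `ℓ` per c-type layer are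
at most `ℓ/(2 b₂)` of the window's surplus (`ledger_hcpCell`; in energy units the ratio is `ℓ/b₂ < 1/990` at the record numerals,
`record_ledger_ratio`) — no run-length threshold, no flank borrowing beyond ONE layer, no reference switch, no `0.28`.  In the PHYSICAL attribution
(the separation-2 virial mismatch of `L` is carried by its c-type NEIGHBOURS — «interface layer: half the virial» — i.e. loss `≤ ℓ·(cNbr/2)²`) the
ledger is even SITE-LOCAL: `ledger_site`, same ratio, on the same layer.  The fcc-cell ledger (losses on h-type layers) provably needs switching: it
already fails for the hcp word (`fccCell_ledger_fails`).  Scope: separation-2 (leading) registry order with an abstract loss constant `ℓ`; the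
per-separation version (virial table `φ_k` against surplus table `b_k`, k ≤ 20) awaits census (ii) and is the companion of «SEAM-k».  Table hypotheses
as in P-R plus `b 3 ≤ 0` (SEAM-62: `b₃ = −1.099·10⁻⁷`, certified negative in all four geometry columns; kernel numeral pending «SEAM-k»).
-/

noncomputable section

open scoped Classical

open Literature.MathematicalPhysics.StatisticalMechanics Literature.Geometry.DiscreteGeometry
open Summit.AtomisticToContinuum.Crystallization.Theses.PricedLinkCensus
open Summit.AtomisticToContinuum.Crystallization.Theorems.ChargedEnergyGapNegative

namespace Summit.AtomisticToContinuum.Crystallization.Theorems.ChargedEnergyGapChartDial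

section StackingLedger

/-- The **c-TYPE INDICATOR** of layer `L` in the word `w`: `1` if the two neighbouring layers carry different letters (locally cubic stacking),
`0` if they carry the same letter (locally hexagonal). -/
def cInd (w : ℤ → Fin 3) (L : ℤ) : ℝ := if w (L - 1) = w (L + 1) then 0 else 1

/-- Number of c-type layers in the window `[A, B]` (as a real). -/
def cCount (w : ℤ → Fin 3) (A B : ℤ) : ℝ := ∑ L ∈ Finset.Icc A B, cInd w L

/-- Number of h-type layers in the window `[A, B]` (as a real). -/
def hCount (w : ℤ → Fin 3) (A B : ℤ) : ℝ := ∑ L ∈ Finset.Icc A B, (1 - cInd w L)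

variable {b : ℕ → ℝ} {w : ℤ → Fin 3}

/-- `cInd_nonneg` (docstring added by the landing lane; see the module docstring). [formal bookkeeping] -/
theorem cInd_nonneg (w : ℤ → Fin 3) (L : ℤ) : 0 ≤ cInd w L := by
  unfold cInd; split_ifs <;> norm_num

/-- `cInd_le_one` (docstring added by the landing lane; see the module docstring). [formal bookkeeping] -/
theorem cInd_le_one (w : ℤ → Fin 3) (L : ℤ) : cInd w L ≤ 1 := by
  unfold cInd; split_ifs <;> norm_num

/-- The separation-3 registry term is `≥ 0` when `b 3 ≤ 0`. -/
theorem registryTerm_three_nonneg (hb3 : b 3 ≤ 0) (w : ℤ → Fin 3) (L s : ℤ) : 0 ≤ registryTerm b w L s 3 := by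
  unfold registryTerm
  rw [if_neg (by decide : ¬ Even 3)]
  split_ifs <;> linarith

/-- The separation-2 registry term of `L` in direction `ε = ±1` is `b 2 ×` the c-type indicator of the NEIGHBOUR `L + ε`. -/
theorem registryTerm_two_eq (b : ℕ → ℝ) (w : ℤ → Fin 3) (L : ℤ) {ε : ℤ} (hε : ε = 1 ∨ ε = -1) :
    registryTerm b w L (ε * 2) 2 = b 2 * cInd w (L + ε) := by
  unfold registryTerm cInd
  rw [if_pos (by decide : Even 2)]
  rcases hε with h | h <;> rw [h]
  · rw [show L + (1 : ℤ) * 2 = L + 2 by ring, show L + 1 - 1 = L by ring, show L + 1 + 1 = L + 2 by ring]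
    by_cases h2 : w (L + 2) = w L
    · rw [if_pos h2, if_pos h2.symm, mul_zero]
    · rw [if_neg h2, if_neg (fun h' => h2 h'.symm), mul_one]
  · rw [show L + (-1 : ℤ) * 2 = L - 2 by ring, show L + -1 - 1 = L - 2 by ring, show L + -1 + 1 = L by ring]
    by_cases h2 : w (L - 2) = w L
    · rw [if_pos h2, if_pos h2, mul_zero]
    · rw [if_neg h2, if_neg h2, mul_one]

/-- ★ **A c-TYPE NEIGHBOUR DEPOSITS `b 2`**: the one-sided surplus of `L` in direction `ε` is at least `b 2 · cInd w (L + ε)`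
(table hypotheses of P-R, `1 ≤ J`, and `b 3 ≤ 0`). -/
theorem wordSurplusSide_ge_cInd (hw : IsBarlowWord w) (L : ℤ) {ε : ℤ} (hε : ε = 1 ∨ ε = -1) {J : ℕ} (hJ : 1 ≤ J)
    (heven : ∀ j < J, 0 ≤ b (2 * j + 2)) (hodd : ∀ j < J, 0 < b (2 * j + 3) → b (2 * j + 3) ≤ b (2 * j + 2)) (hb3 : b 3 ≤ 0) :
    b 2 * cInd w (L + ε) ≤ wordSurplusSide b w L ε J := by
  obtain ⟨J', rfl⟩ : ∃ J', J = J' + 1 := ⟨J - 1, by omega⟩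
  unfold wordSurplusSide
  rw [Finset.sum_range_succ']
  have htail : 0 ≤ ∑ j ∈ Finset.range J', (registryTerm b w L (ε * (2 * (j + 1) + 2 : ℕ)) (2 * (j + 1) + 2)
      + registryTerm b w L (ε * (2 * (j + 1) + 3 : ℕ)) (2 * (j + 1) + 3)) :=
    Finset.sum_nonneg fun j hj =>
      registryPair_nonneg hw L hε (j + 1) (heven (j + 1) (by rw [Finset.mem_range] at hj; omega))
        (hodd (j + 1) (by rw [Finset.mem_range] at hj; omega))
  have h0 : b 2 * cInd w (L + ε) ≤ registryTerm b w L (ε * (2 * 0 + 2 : ℕ)) (2 * 0 + 2) + registryTerm b w L (ε * (2 * 0 + 3 : ℕ)) (2 * 0 + 3) := by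
    simp only [Nat.mul_zero, Nat.zero_add, Nat.cast_ofNat]
    rw [registryTerm_two_eq b w L hε]
    linarith [registryTerm_three_nonneg hb3 w L (ε * 3)]
  linarith

/-- ★ Both sides: `b 2 · (cInd (L+1) + cInd (L−1)) ≤ wordSurplus(L)`. -/
theorem wordSurplus_ge_cInd (hw : IsBarlowWord w) (L : ℤ) {J : ℕ} (hJ : 1 ≤ J)
    (heven : ∀ j < J, 0 ≤ b (2 * j + 2)) (hodd : ∀ j < J, 0 < b (2 * j + 3) → b (2 * j + 3) ≤ b (2 * j + 2)) (hb3 : b 3 ≤ 0) :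
    b 2 * (cInd w (L + 1) + cInd w (L - 1)) ≤ wordSurplus b w L J := by
  have h1 := wordSurplusSide_ge_cInd hw L (Or.inl rfl) hJ heven hodd hb3
  have h2 := wordSurplusSide_ge_cInd hw L (Or.inr rfl) hJ heven hodd hb3
  rw [← sub_eq_add_neg] at h2
  unfold wordSurplus
  linarith

/-- Index shift on integer windows. -/
theorem sum_Icc_shift (g : ℤ → ℝ) (A B c : ℤ) :
    ∑ L ∈ Finset.Icc A B, g L = ∑ L ∈ Finset.Icc (A - c) (B - c), g (L + c) := by
  have : Finset.Icc A B = (Finset.Icc (A - c) (B - c)).map (addRightEmbedding c) := by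
    rw [Finset.map_add_right_Icc, sub_add_cancel, sub_add_cancel]
  rw [this, Finset.sum_map]
  rfl

/-- ★★ **THE WINDOW LEDGER**: in every window `[A, B]` of every Barlow word, `2·b₂·#{c-type layers} ≤ Σ_{L ∈ [A−1, B+1]} wordSurplus(L)`
(each c-type layer is paid by the `k = 2` deposits it makes on its two neighbours, which lie in the window widened by one layer). -/
theorem ledger_window (hw : IsBarlowWord w) {J : ℕ} (hJ : 1 ≤ J)
    (heven : ∀ j < J, 0 ≤ b (2 * j + 2)) (hodd : ∀ j < J, 0 < b (2 * j + 3) → b (2 * j + 3) ≤ b (2 * j + 2)) (hb3 : b 3 ≤ 0)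
    (A B : ℤ) : 2 * b 2 * cCount w A B ≤ ∑ L ∈ Finset.Icc (A - 1) (B + 1), wordSurplus b w L J := by
  have hb2 : 0 ≤ b 2 := by simpa using heven 0 (by omega)
  have hsum : ∑ L ∈ Finset.Icc (A - 1) (B + 1), b 2 * (cInd w (L + 1) + cInd w (L - 1))
      ≤ ∑ L ∈ Finset.Icc (A - 1) (B + 1), wordSurplus b w L J :=
    Finset.sum_le_sum fun L _ => wordSurplus_ge_cInd hw L hJ heven hodd hb3
  rw [← Finset.mul_sum, Finset.sum_add_distrib] at hsum
  have h1 : cCount w A B ≤ ∑ L ∈ Finset.Icc (A - 1) (B + 1), cInd w (L + 1) := by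
    unfold cCount
    rw [sum_Icc_shift (cInd w) A B 1]
    exact Finset.sum_le_sum_of_subset_of_nonneg (Finset.Icc_subset_Icc le_rfl (by linarith)) fun L _ _ => cInd_nonneg w (L + 1)
  have h2 : cCount w A B ≤ ∑ L ∈ Finset.Icc (A - 1) (B + 1), cInd w (L - 1) := by
    unfold cCount
    rw [sum_Icc_shift (cInd w) A B (-1), sub_neg_eq_add, sub_neg_eq_add]
    simp only [← sub_eq_add_neg]
    exact Finset.sum_le_sum_of_subset_of_nonneg (Finset.Icc_subset_Icc (by linarith) le_rfl) fun L _ _ => cInd_nonneg w (L - 1)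
  calc 2 * b 2 * cCount w A B = b 2 * (cCount w A B + cCount w A B) := by ring
    _ ≤ b 2 * (∑ L ∈ Finset.Icc (A - 1) (B + 1), cInd w (L + 1) + ∑ L ∈ Finset.Icc (A - 1) (B + 1), cInd w (L - 1)) :=
      mul_le_mul_of_nonneg_left (add_le_add h1 h2) hb2
    _ ≤ _ := hsum

/-- ★★★ **THE hcp-CELL LEDGER (no switch)**: with the hcp cell as the chart's reference cell the first-order loss `ℓ ≥ 0` falls on the c-type layers,
and in every window of every Barlow word the losses are at most `ℓ/(2 b₂)` of the rigid surplus of the window widened by one layer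
(`= ℓ/b₂` of the per-site ENERGY surplus, which is `½ · wordSurplus` with the census table). -/
theorem ledger_hcpCell (hw : IsBarlowWord w) {J : ℕ} (hJ : 1 ≤ J)
    (heven : ∀ j < J, 0 ≤ b (2 * j + 2)) (hodd : ∀ j < J, 0 < b (2 * j + 3) → b (2 * j + 3) ≤ b (2 * j + 2)) (hb3 : b 3 ≤ 0)
    (hb2 : 0 < b 2) {ℓ : ℝ} (hℓ : 0 ≤ ℓ) (A B : ℤ) :
    ℓ * cCount w A B ≤ ℓ / (2 * b 2) * ∑ L ∈ Finset.Icc (A - 1) (B + 1), wordSurplus b w L J := by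
  have h := ledger_window hw hJ heven hodd hb3 A B
  have hc : cCount w A B ≤ (∑ L ∈ Finset.Icc (A - 1) (B + 1), wordSurplus b w L J) / (2 * b 2) := by
    rw [le_div_iff₀ (by positivity)]; linarith
  calc ℓ * cCount w A B ≤ ℓ * ((∑ L ∈ Finset.Icc (A - 1) (B + 1), wordSurplus b w L J) / (2 * b 2)) :=
      mul_le_mul_of_nonneg_left hc hℓ
    _ = _ := by ring

/-- The **NUMBER OF c-TYPE NEIGHBOURS** of layer `L` (= the number of its two separation-2 registries that are staggered, i.e. differ from hcp's):
`0`, `1` or `2`.  At the hcp cell the separation-2 part of the layer virial of `L` is proportional to this number (memo §1.2 row 1: «interface layer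
half of that»), so the first-order relaxation loss of `L` is `≤ ℓ · (cNbr/2)²` with `ℓ` the loss of a fully cubic environment. -/
def cNbr (w : ℤ → Fin 3) (L : ℤ) : ℝ := cInd w (L + 1) + cInd w (L - 1)

/-- `cNbr_nonneg` (docstring added by the landing lane; see the module docstring). [formal bookkeeping] -/
theorem cNbr_nonneg (w : ℤ → Fin 3) (L : ℤ) : 0 ≤ cNbr w L := by
  unfold cNbr; linarith [cInd_nonneg w (L + 1), cInd_nonneg w (L - 1)]

/-- `cNbr_le_two` (docstring added by the landing lane; see the module docstring). [formal bookkeeping] -/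
theorem cNbr_le_two (w : ℤ → Fin 3) (L : ℤ) : cNbr w L ≤ 2 := by
  unfold cNbr; linarith [cInd_le_one w (L + 1), cInd_le_one w (L - 1)]

/-- ★★★ **THE SITE-LOCAL LEDGER at the hcp cell** (the physical attribution: the separation-2 virial mismatch of `L` is carried by its c-type
NEIGHBOURS, exactly where `L`'s surplus comes from): a loss `≤ ℓ·(cNbr/2)²` is at most `ℓ/(2 b₂) · wordSurplus(L)` ON THE SAME LAYER — no window,
no borrowing, no switch (energy-unit ratio `ℓ/b₂`). -/
theorem ledger_site (hw : IsBarlowWord w) {J : ℕ} (hJ : 1 ≤ J)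
    (heven : ∀ j < J, 0 ≤ b (2 * j + 2)) (hodd : ∀ j < J, 0 < b (2 * j + 3) → b (2 * j + 3) ≤ b (2 * j + 2)) (hb3 : b 3 ≤ 0)
    (hb2 : 0 < b 2) {ℓ : ℝ} (hℓ : 0 ≤ ℓ) (L : ℤ) :
    ℓ * (cNbr w L / 2) ^ 2 ≤ ℓ / (2 * b 2) * wordSurplus b w L J := by
  have hn0 := cNbr_nonneg w L
  have hn2 := cNbr_le_two w L
  have hsq : (cNbr w L / 2) ^ 2 ≤ cNbr w L / 2 := by nlinarith
  have hws : b 2 * cNbr w L ≤ wordSurplus b w L J := wordSurplus_ge_cInd hw L hJ heven hodd hb3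
  calc ℓ * (cNbr w L / 2) ^ 2 ≤ ℓ * (cNbr w L / 2) := mul_le_mul_of_nonneg_left hsq hℓ
    _ = ℓ / (2 * b 2) * (b 2 * cNbr w L) := by field_simp
    _ ≤ ℓ / (2 * b 2) * wordSurplus b w L J := mul_le_mul_of_nonneg_left hws (by positivity)

/-- Every layer of the hcp word is h-type. -/
theorem cInd_hcpWord (L : ℤ) : cInd hcpWord L = 0 := by
  have h : hcpWord (L - 1) = hcpWord (L + 1) := by
    rw [show L + 1 = (L - 1) + 2 by ring]
    exact ((hcpWord_eq_iff (L - 1) 2).2 even_two).symm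
  simp [cInd, h]

/-- ★ **THE fcc-CELL LEDGER NEEDS SWITCHING**: with the fcc cell as the universal reference the loss falls on the h-type layers, and the
window inequality already fails for the hcp word (all layers h-type, all surpluses `0`) — whatever the constant `θ`. -/
theorem fccCell_ledger_fails (b : ℕ → ℝ) (J : ℕ) {ℓ : ℝ} (hℓ : 0 < ℓ) (θ : ℝ) :
    ¬ ∀ A B : ℤ, ℓ * hCount hcpWord A B ≤ θ * ∑ L ∈ Finset.Icc (A - 1) (B + 1), wordSurplus b hcpWord L J := by
  intro h
  have h0 := h 0 0
  have hc : hCount hcpWord 0 0 = 1 := by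
    simp [hCount, cInd_hcpWord]
  rw [hc, mul_one, Finset.sum_congr rfl (fun L _ => wordSurplus_hcp b L J), Finset.sum_const_zero, mul_zero] at h0
  linarith

/-- By contrast the hcp-cell ledger holds in the same ∀-window shape for EVERY Barlow word (restating `ledger_hcpCell`). -/
theorem hcpCell_ledger_holds (hw : IsBarlowWord w) {J : ℕ} (hJ : 1 ≤ J)
    (heven : ∀ j < J, 0 ≤ b (2 * j + 2)) (hodd : ∀ j < J, 0 < b (2 * j + 3) → b (2 * j + 3) ≤ b (2 * j + 2)) (hb3 : b 3 ≤ 0)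
    (hb2 : 0 < b 2) {ℓ : ℝ} (hℓ : 0 ≤ ℓ) :
    ∀ A B : ℤ, ℓ * cCount w A B ≤ ℓ / (2 * b 2) * ∑ L ∈ Finset.Icc (A - 1) (B + 1), wordSurplus b w L J :=
  fun A B => ledger_hcpCell hw hJ heven hodd hb3 hb2 hℓ A B

/-- RECORD NUMERALS (memo §1.2 row 1, SEAM-62): with the census lower rational `b₂ ≥ 7258/10⁸` and the kernel first-order-loss bound
`ℓ₁ < 73/10⁹` (replay value `55/10⁹`) the energy-unit ratio `ℓ₁/b₂` is `< 1/990` (`< 1/1300` at the replay value); the table entry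
`b₃ = −1.099·10⁻⁷ ≤ 0`. -/
theorem record_ledger_ratio :
    (73 / 10 ^ 9 : ℝ) / (7258 / 10 ^ 8) < 1 / 990 ∧ (55 / 10 ^ 9 : ℝ) / (7258 / 10 ^ 8) < 1 / 1300 ∧ (-(1099 / 10 ^ 10) : ℝ) ≤ 0 := by
  norm_num

end StackingLedger

end Summit.AtomisticToContinuum.Crystallization.Theorems.ChargedEnergyGapChartDial
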